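import Literature.Topology.FourManifolds.RegularInterval
import Mathlib.Geometry.Manifold.IntegralCurve.ExistUnique
import Mathlib.Geometry.Manifold.IntegralCurve.Transform
import Mathlib.Analysis.SpecialFunctions.SmoothTransition
import Mathlib.Analysis.SpecialFunctions.Log.Deriv
import HarnessLib

/-!
# A level function along the flow of a field `W` with `dF(W) = 2 (F - b)` (flow layer, part 1)

Auxiliary file (part 1 of 2) of helper `helper_bott_flow` of stub
`helper_sliceGluing_bottRecognition` (fibred Morse–Bott recognition of the polar tube), line
`Sketch`, crux `SblfDescent.RungOne`.

(Crux item stmt-SmoothPoincare4-18531; skeleton `Cruxes/RungOne/Lines/Sketch.lean`.)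

Milnor's proof of the regular interval theorem (*Morse theory* (1963), Thm. 3.1) pushes level
sets along the flow `θ` of a field `X` normalised by `X(f) = 1`, so that `f (θ_t q) = f q + t`
"as long as `f (θ_t q)` lies between `a` and `b`".  About a Morse–Bott maximum circle at the
level `b` the convenient normalisation is `W(F) = 2 (F - b)` (in Morse–Bott coordinates
`F = b - ‖y‖²` it is satisfied by the Euler field `y ∂_y`, which is smooth across the critical
circle), and the conclusion becomes `b - F (θ_t x) = (b - F x) e^{2t}` as long as the trajectory
stays in `{a ≤ F}`; a smooth first integral `h` of `W` over `{a ≤ F}` (`dh(W) = 0` there) is then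
constant along these arcs.  This file proves these two statements
(`BottFlow.sub_apply_flow_eq`, `BottFlow.apply_flow_eq_of_mfderiv_eq_zero`) for a global flow
`θ` of `W` on a manifold (any real model), from the real-variable lemma
`BottFlow.eq_add_of_deriv_eq_one_of_le` ("`g' = 1` whenever `g ≤ hi`, and `g 0 ≤ hi`, give
`g t = g 0 + t` for `t ≤ hi - g 0`"; the function being `g = ½ log (b - F ∘ θ)`), together with
the fixed points of the flow at the zeros of `W` and a smooth profile `λ` (`= 1` near `0`,
`= s/s₀` for large `s`) used in part 2 to interpolate between the tube and the flow.

## References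

* J. Milnor, *Morse theory*, Ann. of Math. Studies 51 (1963), proof of Thm. 3.1. [Milnor1963]
* J. M. Lee, *Introduction to Smooth Manifolds*, 2nd ed. (2012), Thm. 9.12. [LeeSmoothManifolds2013]
-/

set_option linter.dupNamespace false

noncomputable section

open scoped Manifold ContDiff Topology
open Set Function Filter Metric Literature.Topology.FourManifolds

namespace Summit.SmoothPoincare4.SmoothPoincare4.Cruxes.RungOne.Sketch

namespace BottFlow

/-! ### Real analysis: unit speed below a ceiling -/

/-- **No return from above the ceiling.**  If `g` is differentiable with `g' t = 1` whenever
`g t ≤ hi`, and `g t₂ ≤ hi`, then `g t ≤ hi` for all `t ≤ t₂` (at the first time after `t` at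
which `g ≤ hi` the function would have to be increasing through the ceiling from above).
[folklore] -/
theorem le_of_deriv_eq_one_of_le {g g' : ℝ → ℝ} {hi : ℝ} (hg : ∀ t, HasDerivAt g (g' t) t)
    (h1 : ∀ t, g t ≤ hi → g' t = 1) {t₂ : ℝ} (h2 : g t₂ ≤ hi) {t : ℝ} (ht : t ≤ t₂) :
    g t ≤ hi := by
  by_contra hgt
  rw [not_le] at hgt
  have hcont : Continuous g := continuous_iff_continuousAt.2 fun s => (hg s).continuousAt
  have htlt : t < t₂ := lt_of_le_of_ne ht (by rintro rfl; exact absurd h2 (not_le.2 hgt))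
  set S : Set ℝ := {s | s ∈ Icc t t₂ ∧ g s ≤ hi} with hS
  have hSc : IsClosed S := isClosed_Icc.inter (isClosed_le hcont continuous_const)
  have hSne : S.Nonempty := ⟨t₂, ⟨ht, le_rfl⟩, h2⟩
  have hSbdd : BddBelow S := ⟨t, fun s hs => hs.1.1⟩
  set s₀ := sInf S with hs₀
  have hs₀S : s₀ ∈ S := hSc.csInf_mem hSne hSbdd
  have hts₀ : t < s₀ := lt_of_le_of_ne hs₀S.1.1 (by rintro h; rw [← h] at hs₀S; exact absurd hs₀S.2 (not_le.2 hgt))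
  -- `g' s₀ = 1 > 0`: just before `s₀` the function is below `g s₀ ≤ hi`
  have hder : HasDerivAt g 1 s₀ := by rw [← h1 s₀ hs₀S.2]; exact hg s₀
  have hslope : ∀ᶠ s in 𝓝[≠] s₀, 0 < slope g s₀ s :=
    (hasDerivAt_iff_tendsto_slope.1 hder).eventually (lt_mem_nhds one_pos)
  rw [eventually_nhdsWithin_iff, Metric.eventually_nhds_iff] at hslope
  obtain ⟨δ, hδ, hδslope⟩ := hslope
  set s := max t (s₀ - δ / 2) with hs
  have hss₀ : s < s₀ := max_lt hts₀ (by linarith)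
  have hsdist : dist s s₀ < δ := by
    rw [Real.dist_eq, abs_lt]
    constructor <;> [have := le_max_right t (s₀ - δ / 2); skip] <;> linarith
  have hsl := hδslope hsdist hss₀.ne
  rw [slope_def_field] at hsl
  have hgs : g s < g s₀ := by
    have hneg : s - s₀ < 0 := by linarith
    by_contra hle
    rw [not_lt] at hle
    have : (g s - g s₀) / (s - s₀) ≤ 0 := div_nonpos_of_nonneg_of_nonpos (by linarith) hneg.le
    linarith
  have hsS : s ∈ S := ⟨⟨le_max_left _ _, hss₀.le.trans hs₀S.1.2⟩, by linarith [hs₀S.2]⟩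
  have := csInf_le hSbdd hsS
  linarith

/-- **Unit speed below a ceiling** (Milnor 1963, proof of Thm. 3.1: "`t ↦ f(φ_t(q))` has
derivative `1` as long as `f(φ_t(q))` lies between `a` and `b`", in the one-sided form used
about a maximum).  Let `g : ℝ → ℝ` be differentiable with `g' t = 1` whenever `g t ≤ hi`, and
`g 0 ≤ hi`.  Then `g t = g 0 + t` for every `t ≤ hi - g 0`. [cite: Milnor1963, proof of Thm. 3.1] -/
theorem eq_add_of_deriv_eq_one_of_le {g g' : ℝ → ℝ} {hi : ℝ} (hg : ∀ t, HasDerivAt g (g' t) t)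
    (h1 : ∀ t, g t ≤ hi → g' t = 1) (h0 : g 0 ≤ hi) {t : ℝ} (ht : t ≤ hi - g 0) :
    g t = g 0 + t := by
  have hcont : Continuous g := continuous_iff_continuousAt.2 fun s => (hg s).continuousAt
  -- `φ = g - id` has derivative `0` wherever `g ≤ hi`
  have hφ : ∀ s, g s ≤ hi → HasDerivAt (fun r => g r - r) 0 s := fun s hs => by
    have h := (hg s).sub (hasDerivAt_id s)
    rwa [h1 s hs, sub_self] at h
  rcases le_or_gt t 0 with ht0 | ht0
  · -- backward: `g ≤ hi` on `(-∞, 0]`, so `g - id` is constant on `[t, 0]`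
    have hle : ∀ s ≤ 0, g s ≤ hi := fun s hs => le_of_deriv_eq_one_of_le hg h1 h0 hs
    have hconst := constant_of_has_deriv_right_zero (f := fun r => g r - r) (a := t) (b := 0)
      ((hcont.sub continuous_id).continuousOn)
      (fun s hs => (hφ s (hle s hs.2.le)).hasDerivWithinAt) 0 ⟨ht0, le_rfl⟩
    simp only [sub_zero] at hconst
    linarith
  · -- forward: the band lemma up to any `T < hi - g 0`, and continuity at the endpoint
    have hband : ∀ T, 0 ≤ T → T < hi - g 0 → g T = g 0 + T := fun T hT hT' => by
      have h := UnitSpeed.eq_add_of_deriv_eq_one hg (lo := g 0 - 1) (hi := hi)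
        (fun s hs => h1 s hs.2.le) (t₀ := 0) (T := T) (by linarith) (by linarith) T ⟨hT, le_rfl⟩
      rwa [zero_add] at h
    rcases lt_or_eq_of_le ht with hlt | heq
    · exact hband t ht0.le hlt
    · -- the endpoint `t = hi - g 0 > 0`: closedness of `{s | g s = g 0 + s}`
      have hclosed : IsClosed {s | g s = g 0 + s} :=
        isClosed_eq hcont (continuous_const.add continuous_id)
      have hsub : Ioo 0 t ⊆ {s | g s = g 0 + s} := fun s hs => hband s hs.1.le (heq ▸ hs.2)
      have hmem : t ∈ closure (Ioo 0 t) := by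
        rw [closure_Ioo ht0.ne]; exact right_mem_Icc.2 ht0.le
      exact hclosed.closure_subset_iff.2 hsub hmem

/-! ### A smooth interpolation profile -/

/-- **A smooth interpolation profile**: for `s₀ > 0` there is a `C^∞` function `λ : ℝ → ℝ` with
`λ(s) = 1` for `s ≤ s₀`, `λ ≥ 1` everywhere, and `s / λ(s) ≤ 2 s₀` for all `s` (take
`λ(s) = 1 + S((s - s₀)/s₀) (s/s₀ - 1)` with `S` the smooth transition: `= s/s₀` for `s ≥ 2 s₀`).
[folklore] -/
theorem exists_profile {s₀ : ℝ} (hs₀ : 0 < s₀) : ∃ lam : ℝ → ℝ, ContDiff ℝ ∞ lam ∧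
    (∀ s, s ≤ s₀ → lam s = 1) ∧ (∀ s, 1 ≤ lam s) ∧ ∀ s, s / lam s ≤ 2 * s₀ := by
  set lam : ℝ → ℝ := fun s => 1 + Real.smoothTransition ((s - s₀) / s₀) * (s / s₀ - 1) with hlam
  have hsmooth : ContDiff ℝ ∞ lam :=
    contDiff_const.add ((Real.smoothTransition.contDiff.comp
      ((contDiff_id.sub contDiff_const).div_const _)).mul ((contDiff_id.div_const _).sub contDiff_const))
  have hle : ∀ s, s ≤ s₀ → lam s = 1 := fun s hs => by
    simp only [hlam]
    rw [Real.smoothTransition.zero_of_nonpos (div_nonpos_of_nonpos_of_nonneg (by linarith) hs₀.le)]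
    ring
  have hge : ∀ s, 2 * s₀ ≤ s → lam s = s / s₀ := fun s hs => by
    simp only [hlam]
    rw [Real.smoothTransition.one_of_one_le ((one_le_div hs₀).2 (by linarith))]
    ring
  have hone : ∀ s, 1 ≤ lam s := fun s => by
    rcases le_or_gt s s₀ with hs | hs
    · rw [hle s hs]
    · simp only [hlam]
      have h1 : 0 ≤ Real.smoothTransition ((s - s₀) / s₀) := Real.smoothTransition.nonneg _
      have h2 : 0 ≤ s / s₀ - 1 := by rw [sub_nonneg, one_le_div hs₀]; exact hs.le
      nlinarith
  refine ⟨lam, hsmooth, hle, hone, fun s => ?_⟩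
  have hpos : 0 < lam s := lt_of_lt_of_le one_pos (hone s)
  rw [div_le_iff₀ hpos]
  rcases le_or_gt s s₀ with hs | hs
  · rw [hle s hs]; linarith
  rcases le_or_gt (2 * s₀) s with hs' | hs'
  · rw [hge s hs', mul_assoc, mul_div_cancel₀ _ hs₀.ne']; linarith
  · have := hone s
    nlinarith

/-! ### Along the flow of `W`: fixed points, the level `F`, first integrals -/

section Manifold

universe uE uH uM

variable {E : Type uE} [NormedAddCommGroup E] [NormedSpace ℝ E]
  {H : Type uH} [TopologicalSpace H] {I : ModelWithCorners ℝ E H}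
  {M : Type uM} [TopologicalSpace M] [ChartedSpace H M]
  {W : Π x : M, TangentSpace I x} {θ : ℝ × M → M}

/-- Along an integral curve `γ` of `ξ`, a smooth vector-valued `f ∘ γ` has derivative
`df(ξ_{γ(t)})` (the vector-valued form of `hasDerivAt_comp_integralCurve`). [folklore] -/
theorem hasDerivAt_comp_integralCurve_vec {E' : Type*} [NormedAddCommGroup E'] [NormedSpace ℝ E']
    {f : M → E'} (hf : ContMDiff I 𝓘(ℝ, E') ∞ f)
    {ξ : Π x : M, TangentSpace I x} {γ : ℝ → M} (hγ : IsMIntegralCurve γ ξ) (t : ℝ) :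
    HasDerivAt (f ∘ γ) (mfderiv I 𝓘(ℝ, E') f (γ t) (ξ (γ t))) t := by
  have h1 : HasMFDerivAt 𝓘(ℝ, ℝ) 𝓘(ℝ, E') (f ∘ γ) t
      ((mfderiv I 𝓘(ℝ, E') f (γ t)).comp ((1 : ℝ →L[ℝ] ℝ).smulRight (ξ (γ t)))) :=
    ((hf.mdifferentiableAt (by simp)).hasMFDerivAt).comp t (hγ t)
  have h2 : HasFDerivAt (f ∘ γ)
      ((mfderiv I 𝓘(ℝ, E') f (γ t)).comp ((1 : ℝ →L[ℝ] ℝ).smulRight (ξ (γ t)))) t :=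
    hasMFDerivAt_iff_hasFDerivAt.1 h1
  have h3 : ((mfderiv I 𝓘(ℝ, E') f (γ t)).comp ((1 : ℝ →L[ℝ] ℝ).smulRight (ξ (γ t))) :
      ℝ →L[ℝ] E') = (1 : ℝ →L[ℝ] ℝ).smulRight (mfderiv I 𝓘(ℝ, E') f (γ t) (ξ (γ t))) := by
    apply ContinuousLinearMap.ext_ring
    simp
  exact hasDerivAt_iff_hasFDerivAt.2 (h2.congr_fderiv h3)

/-- **Zeros of the field are fixed points of the flow** (uniqueness of integral curves on a
manifold without boundary: the constant curve is an integral curve). [cite: LeeSmoothManifolds2013, Thm. 9.12] -/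
theorem flow_apply_of_eq_zero [IsManifold I ∞ M] [T2Space M] [BoundarylessManifold I M]
    (hW : ContMDiff I I.tangent ∞ (fun x => (⟨x, W x⟩ : TangentBundle I M)))
    (hθ0 : ∀ p, θ (0, p) = p) (hθint : ∀ p, IsMIntegralCurve (fun t => θ (t, p)) W)
    {x : M} (hx : W x = 0) (t : ℝ) : θ (t, x) = x := by
  have h := isMIntegralCurve_Ioo_eq_of_contMDiff_boundaryless (t₀ := 0) (hW.of_le (by norm_cast))
    (hθint x) (isMIntegralCurve_const hx) (by simp [hθ0])
  exact congrFun h t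

/-- **The level along the flow of `W`, `W(F) = 2 (F - b)` on `{a ≤ F}`** (Milnor 1963, proof of
Thm. 3.1, with this normalisation).  If `θ` is a flow of `W` (`θ (0, p) = p`, curves integral),
`F` is smooth with `dF(W z) = 2 (F z - b)` whenever `a ≤ F z`, and `x` is a point with
`a ≤ F x` whose trajectory stays in `{F < b}`, then
`b - F (θ (t, x)) = (b - F x) e^{2t}` for every `t` with `(b - F x) e^{2t} ≤ b - a`.
[cite: Milnor1963, proof of Thm. 3.1] -/
theorem sub_apply_flow_eq {F : M → ℝ} (hF : ContMDiff I 𝓘(ℝ, ℝ) ∞ F)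
    (hθ0 : ∀ p, θ (0, p) = p) (hθint : ∀ p, IsMIntegralCurve (fun t => θ (t, p)) W)
    {a b : ℝ} (hcons : ∀ z, a ≤ F z → mfderiv I 𝓘(ℝ, ℝ) F z (W z) = 2 * (F z - b))
    {x : M} (hx : a ≤ F x) (hlt : ∀ t, F (θ (t, x)) < b) {t : ℝ}
    (ht : (b - F x) * Real.exp (2 * t) ≤ b - a) :
    b - F (θ (t, x)) = (b - F x) * Real.exp (2 * t) := by
  have hpos : ∀ s, 0 < b - F (θ (s, x)) := fun s => by linarith [hlt s]
  have hx0 : 0 < b - F x := by have := hpos 0; rwa [hθ0] at this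
  have hba : 0 < b - a := lt_of_lt_of_le (mul_pos hx0 (Real.exp_pos _)) ht
  -- `g = ½ log (b - F ∘ θ)` has derivative `-dF(W)/(2 (b - F))`
  set g : ℝ → ℝ := fun s => 1 / 2 * Real.log (b - F (θ (s, x))) with hg
  set g' : ℝ → ℝ := fun s =>
    1 / 2 * (-(mlineDeriv I F (θ (s, x)) (W (θ (s, x)))) / (b - F (θ (s, x)))) with hg'
  have hder : ∀ s, HasDerivAt g (g' s) s := fun s => by
    have h1 : HasDerivAt (fun r => b - F (θ (r, x))) (-(mlineDeriv I F (θ (s, x)) (W (θ (s, x))))) s := by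
      have h := hasDerivAt_comp_integralCurve hF (hθint x) s
      have h' := (hasDerivAt_const s b).sub h
      rwa [zero_sub] at h'
    exact (h1.log (hpos s).ne').const_mul (1 / 2)
  -- `g' = 1` wherever `g ≤ ½ log (b - a)`, i.e. wherever `a ≤ F`
  have h1 : ∀ s, g s ≤ 1 / 2 * Real.log (b - a) → g' s = 1 := fun s hs => by
    have hle : b - F (θ (s, x)) ≤ b - a := by
      have h2 : Real.log (b - F (θ (s, x))) ≤ Real.log (b - a) := by
        simp only [hg] at hs; linarith
      exact (Real.log_le_log_iff (hpos s) hba).1 h2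
    have hc : mlineDeriv I F (θ (s, x)) (W (θ (s, x))) = 2 * (F (θ (s, x)) - b) :=
      hcons (θ (s, x)) (by linarith)
    simp only [hg']
    rw [hc, show -(2 * (F (θ (s, x)) - b)) = 2 * (b - F (θ (s, x))) by ring, mul_div_assoc,
      div_self (hpos s).ne']
    norm_num
  have h0 : g 0 ≤ 1 / 2 * Real.log (b - a) := by
    simp only [hg, hθ0]
    have : Real.log (b - F x) ≤ Real.log (b - a) := Real.log_le_log hx0 (by linarith)
    linarith
  -- the condition on `t` is `t ≤ ½ log (b - a) - g 0`
  have ht' : t ≤ 1 / 2 * Real.log (b - a) - g 0 := by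
    simp only [hg, hθ0]
    have h2 : Real.log ((b - F x) * Real.exp (2 * t)) ≤ Real.log (b - a) :=
      Real.log_le_log (mul_pos hx0 (Real.exp_pos _)) ht
    rw [Real.log_mul hx0.ne' (Real.exp_pos _).ne', Real.log_exp] at h2
    linarith
  have key := eq_add_of_deriv_eq_one_of_le hder h1 h0 ht'
  -- exponentiate
  have e1 : Real.exp (2 * g t) = b - F (θ (t, x)) := by
    simp only [hg]
    rw [← mul_assoc, show (2 : ℝ) * (1 / 2) = 1 by norm_num, one_mul, Real.exp_log (hpos t)]
  have e2 : Real.exp (2 * (g 0 + t)) = (b - F x) * Real.exp (2 * t) := by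
    simp only [hg, hθ0]
    rw [mul_add, Real.exp_add, ← mul_assoc, show (2 : ℝ) * (1 / 2) = 1 by norm_num, one_mul,
      Real.exp_log hx0]
  rw [← e1, key, e2]

/-- **First integrals along the flow.**  Under the hypotheses of `sub_apply_flow_eq`, a smooth
vector-valued `h` with `dh(W z) = 0` whenever `a ≤ F z` is constant along the arc of trajectory
from `x` to `θ (t, x)`: `h (θ (t, x)) = h x`. [folklore] -/
theorem apply_flow_eq_of_mfderiv_eq_zero {E' : Type*} [NormedAddCommGroup E'] [NormedSpace ℝ E']
    {F : M → ℝ} (hF : ContMDiff I 𝓘(ℝ, ℝ) ∞ F)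
    (hθ0 : ∀ p, θ (0, p) = p) (hθint : ∀ p, IsMIntegralCurve (fun t => θ (t, p)) W)
    {a b : ℝ} (hcons : ∀ z, a ≤ F z → mfderiv I 𝓘(ℝ, ℝ) F z (W z) = 2 * (F z - b))
    {h : M → E'} (hh : ContMDiff I 𝓘(ℝ, E') ∞ h)
    (hconsh : ∀ z, a ≤ F z → mfderiv I 𝓘(ℝ, E') h z (W z) = 0)
    {x : M} (hx : a ≤ F x) (hlt : ∀ t, F (θ (t, x)) < b) {t : ℝ}
    (ht : (b - F x) * Real.exp (2 * t) ≤ b - a) :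
    h (θ (t, x)) = h x := by
  have hx0 : 0 < b - F x := by have := hlt 0; rw [hθ0] at this; linarith
  -- along `[min t 0, max t 0]` the trajectory stays in `{a ≤ F}`
  have hstay : ∀ s, s ≤ max t 0 → a ≤ F (θ (s, x)) := fun s hs => by
    have hs' : (b - F x) * Real.exp (2 * s) ≤ b - a := by
      rcases le_or_gt t 0 with ht0 | ht0
      · rw [max_eq_right ht0] at hs
        calc (b - F x) * Real.exp (2 * s) ≤ (b - F x) * Real.exp (2 * 0) := by gcongr
          _ = b - F x := by simp
          _ ≤ b - a := by linarith
      · rw [max_eq_left ht0.le] at hs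
        calc (b - F x) * Real.exp (2 * s) ≤ (b - F x) * Real.exp (2 * t) := by gcongr
          _ ≤ b - a := ht
    have := sub_apply_flow_eq hF hθ0 hθint hcons hx hlt hs'
    have : 0 ≤ (b - F x) * Real.exp (2 * s) := (mul_pos hx0 (Real.exp_pos _)).le
    linarith
  have hcont : Continuous fun s => h (θ (s, x)) :=
    continuous_iff_continuousAt.2 fun s => (hasDerivAt_comp_integralCurve_vec hh (hθint x) s).continuousAt
  have hconst := constant_of_has_deriv_right_zero (f := fun s => h (θ (s, x))) (a := min t 0) (b := max t 0)
    hcont.continuousOn (fun s hs => by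
      have hd := hasDerivAt_comp_integralCurve_vec hh (hθint x) s
      rw [hconsh _ (hstay s hs.2.le)] at hd
      exact hd.hasDerivWithinAt)
  have h1 := hconst t ⟨min_le_left _ _, le_max_left _ _⟩
  have h2 := hconst 0 ⟨min_le_right _ _, le_max_right _ _⟩
  rw [hθ0] at h2
  rw [h1, ← h2]

end Manifold

end BottFlow

end Summit.SmoothPoincare4.SmoothPoincare4.Cruxes.RungOne.Sketch

end
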